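import Summits.ResolutionOfSingularities.ResolutionOfSingularities.Theorems.EquisingularLiftEquisingularLiftNatSubmaxLineShape
import Summits.ResolutionOfSingularities.ResolutionOfSingularities.Theorems.EquisingularLiftEquisingularLiftBlowupModelTransport
import HarnessLib

/-!
# Crux `EquisingularLift` (stmt-ResolutionOfSingularities-15660), line `Sketch` (v10c): the open residual's conclusion — a REGULAR BLOW-UP MODEL —
# for every integral surface of `ℙ³_k̄` with a line of multiplicity `≥ deg − 1`, in the CRUX'S OWN BINDER SHAPE `(H, ι)`, every characteristic

[OURS · leafhand-res-equisingularlift-7 g0, 2026-08-31; cell `pub/decomp-res`] AI-produced, weaker than expert review; NOT a statement of any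
manuscript; nothing here proves resolution of singularities in positive characteristic.  DEF-FREE helper (`--supports stmt-…-15660`); no `sorry`;
standard axioms; ZERO named hypotheses.

Bookkeeping over ✓ `SubmaxLine.blowupModel_of_prime` (p822337: `V₊(x₀·A + x₁·B + C(x₂,x₃))` prime has a non-zero ideal sheaf — the trace of the
line — all of whose blow-ups are regular), ✓ `SubmaxLine.exists_shape_of_mem_pow` (forms of degree `d + 2` in `(x₂,x₃)^{d+1}` have that shape) and
lh6 g2's transport ✓ `StrataSplit.blowupModel_of_range_eq` (p817268: regular blow-up models pass from `hypersurface F` to every integral `(H, ι)`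
with `range ι = V₊(F)`):

* ★ `blowupModel_of_range_eq_submaxLine` — the crux's binders `ι : H ↪ ℙ³_k` (closed immersion, `H` integral) with `range ι = V₊(F)`,
  `F = x₀·A(x₂,x₃) + x₁·B(x₂,x₃) + C(x₂,x₃)` prime (`A, B` forms of degree `d + 1`, `C` of degree `d + 2`), `k = k̄`: `∃ 𝔞 ≠ ⊥` on `H` with all
  blow-ups regular;
* ★★ `blowupModel_of_range_eq_of_mem_pow` — the same for every PRIME form `F` of degree `d + 2` with `F ∈ (x₂, x₃)^{d+1}`: **every integral
  surface in `ℙ³_k̄` with a line (placed at `V(x₂,x₃)`) of multiplicity `≥ deg − 1` has a regular blow-up model** — the `n = 3` leaf of line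
  `Sketch` (`stub_blowupModel_three`, there conditional on Lipman / CJS) UNCONDITIONALLY on this family, every `p`; e.g. every integral cubic surface
  singular along a line.

Honest label: no registered stub closed; `stub_blowupModel_ge_five` (dimension `≥ 4`) untouched.
-/

set_option linter.dupNamespace false -- mandated namespace `Summit.<Summit>.<Problem>` of this single-conjunct summit

noncomputable section

open CategoryTheory CategoryTheory.Limits AlgebraicGeometry TopologicalSpace
open MvPolynomial
open Literature.AlgebraicGeometry.Resolution
open Literature.AlgebraicGeometry.Motives Literature.AlgebraicGeometry.Motives.SmoothHypersurface
open Literature.AlgebraicGeometry.Motives.ProjectiveSpace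
open Summit.ResolutionOfSingularities.ResolutionOfSingularities.Cruxes.EquisingularLiftNat.Sections

namespace Summit.ResolutionOfSingularities.ResolutionOfSingularities.Cruxes.EquisingularLift.StrataSplit

variable {k : Type} [Field k] [IsAlgClosed k] {d : ℕ}

/-- ★ **Regular blow-up model in the crux's binder shape, `ABC`-form**: for a closed immersion `ι : H ↪ ℙ³_k` with `H` integral and
`range ι = V₊(F)`, `F = x₀·A(x₂,x₃) + x₁·B(x₂,x₃) + C(x₂,x₃)` prime, `H` carries a non-zero ideal sheaf all of whose blow-ups are regular
(✓ `SubmaxLine.blowupModel_of_prime` + ✓ `blowupModel_of_range_eq`). [OURS · lh7] [cite: Hartshorne1977, II Cor. 5.16] -/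
theorem blowupModel_of_range_eq_submaxLine {H : Scheme.{0}} (ι : H ⟶ (projectiveSpace (2 + 1) k).left) [IsClosedImmersion ι] [IsIntegral H]
    (A B C : MvPolynomial (Fin 2) k) (hA : A.IsHomogeneous (d + 1)) (hB : B.IsHomogeneous (d + 1)) (hC : C.IsHomogeneous (d + 2))
    (F : MvPolynomial (Fin (2 + 2)) k)
    (hF : F = X 0 * rename (![2, 3] : Fin 2 → Fin 4) A + X 1 * rename (![2, 3] : Fin 2 → Fin 4) B + rename (![2, 3] : Fin 2 → Fin 4) C)
    (hprime : Prime F)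
    (hrange : letI := MvPolynomial.gradedAlgebra (σ := Fin (2 + 2)) (R := k)
      Set.range ι = {x : Proj (homogeneousSubmodule (Fin (2 + 2)) k) | F ∈ x.asHomogeneousIdeal}) :
    ∃ 𝔞 : H.IdealSheafData, 𝔞 ≠ ⊥ ∧ ∀ (Z : Scheme.{0}) (π : Z ⟶ H), IsBlowup π 𝔞 → Scheme.IsRegular Z :=
  blowupModel_of_range_eq ι F (SubmaxLine.isHomogeneous_F k A B C hA hB hC F hF) hprime hrange
    (SubmaxLine.blowupModel_of_prime k A B C hA hB hC F hF hprime)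

/-- ★★ **REGULAR BLOW-UP MODEL FOR EVERY INTEGRAL SURFACE OF `ℙ³_k̄` WITH A LINE OF MULTIPLICITY `≥ deg − 1`** (the line placed at
`V(x₂, x₃)`), in the crux's binder shape: `ι : H ↪ ℙ³_k` a closed immersion, `H` integral, `range ι = V₊(F)` with `F` a PRIME form of degree `d + 2`
in `(x₂, x₃)^{d+1}` ⟹ `∃ 𝔞 ≠ ⊥` on `H` all of whose blow-ups are regular — every characteristic (✓ `SubmaxLine.exists_shape_of_mem_pow` +
`blowupModel_of_range_eq_submaxLine`).  The `n = 3` leaf of line `Sketch` on this family, unconditionally. [OURS · lh7] [cite: Hartshorne1977, II Cor. 5.16] -/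
theorem blowupModel_of_range_eq_of_mem_pow {H : Scheme.{0}} (ι : H ⟶ (projectiveSpace (2 + 1) k).left) [IsClosedImmersion ι] [IsIntegral H]
    (F : MvPolynomial (Fin (2 + 2)) k) (hF : F.IsHomogeneous (d + 2)) (hprime : Prime F)
    (hmem : F ∈ (Ideal.span {(X 2 : MvPolynomial (Fin 4) k), X 3}) ^ (d + 1))
    (hrange : letI := MvPolynomial.gradedAlgebra (σ := Fin (2 + 2)) (R := k)
      Set.range ι = {x : Proj (homogeneousSubmodule (Fin (2 + 2)) k) | F ∈ x.asHomogeneousIdeal}) :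
    ∃ 𝔞 : H.IdealSheafData, 𝔞 ≠ ⊥ ∧ ∀ (Z : Scheme.{0}) (π : Z ⟶ H), IsBlowup π 𝔞 → Scheme.IsRegular Z := by
  obtain ⟨A, B, C, hA, hB, hC, hFeq⟩ := SubmaxLine.exists_shape_of_mem_pow k F hF hmem
  exact blowupModel_of_range_eq_submaxLine ι A B C hA hB hC F hFeq hprime hrange

end Summit.ResolutionOfSingularities.ResolutionOfSingularities.Cruxes.EquisingularLift.StrataSplit

end
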